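import Summits.BirchSwinnertonDyer.BirchSwinnertonDyer.Theorems.Rank1ResidualJetCoreVertexBridge
import HarnessLib

/-!
# Route `ErratumRoadFive`, crux `EulerHalfPOnlyMultPotMultTwinAtFive` (23444), line `genus`, stub S4♯, child (b)
# `GenusKolyvaginPointDivAtP`: Jetchev's road K — McCallum Prop. 5.2 + Jetchev Prop. 5.3 + Thm. 6.3 ⟹ global
# divisibility — as FRAME-FREE bookkeeping over an ABSTRACT family of points
# (seat `bsd-idea-9` g25, line owner, lens «programme completion»; helper `--supports 23444 --as helper`)

THEOREMS ONLY (no definition, no named fact, no `sorry`); no curve, no field, no Heegner point occurs in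
this file. HONEST FRAMING: nothing here proves a divisibility; it proves that the road-K DEDUCTION
(`JET.derivedPoint_divisible_of_prop52_of_section6_min`, p487923; `JET.exists_coreVertex_of_coreVertexExistence`
and `JET.jetchevDivisibilityCarrierMult_of_prop52_of_coreVertexExistence`, `Rank1ResidualJetCoreVertexBridge.lean`)
does not use the Heegner frame. BSD is proved for no curve; items 19715 ∕ 20529 ∕ 23444 stay open.

WHY. Road K reads, in the kernel, `K3 ⟸ {McCallum 1991 Prop. 5.2 (C = {0}), Jetchev 2008 Prop. 5.3 (core
vertices), [J] Thm. 6.3 instantiated on the row objects}` for the family of Kolyvagin's derived Heegner points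
`d.derivedPoint`, `d : KolyvaginHeegnerData Dt β ι c` (frame = Heegner hypothesis + modular parametrisation).
The genus line's child (b) (`…Cruxes.EulerHalfPOnlyMultPotMultTwinAtFive.GenusKolyvaginPointDivAtP`, skeleton
v1.7) asks the SAME divisibility for ANOTHER family of points in the SAME groups `E(K[c])`: the transported
genus-Heegner points `P_c = Σ_T D_c Θ_{ϑ'}(y_{E′,c})` (no Heegner hypothesis for `W`). Inspection of the three
road-K proofs shows that the frame enters ONLY through (i) the type of the datum `d` at each conductor,
(ii) the point `P(c, d)`, (iii) the three printed inputs, themselves statements about the family; the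
core-vertex predicate (`Jetchev2008.IsGlobalCoreVertex W K ι τ p k c`: the Kummer Selmer structure of `E/K`
modified at `c`) and all of §6 are frame-free. This file RE-RUNS the deduction over abstract data:

* a predicate `IsK` («Kolyvagin prime»), an index `idx : ℕ → ℕ` («`M(ℓ)`») and `Midx : ℕ → ℕ∞` («`M(c)`»)
  with `hMidx : s ≤ Midx c ↔ ∀ ℓ ∣ c prime, s ≤ idx ℓ` (for Zhang's `levelIndex`: `natCast_le_levelIndex_iff`);
* a datum type `D c` and points `P c d : A c` in abelian groups `A c` («`E(K[c])`») without `p`-torsion at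
  the conductors in play (`hA`; for `E(K[c])` this is x11b3's `RingClassNoTorsion`);
* a predicate `Core k c` («core vertex for `k`»);
* `h52` = McCallum Prop. 5.2, case `C = {0}`, FOR THIS FAMILY (shape of
  `McCallum1991.prop52_exists_conductor_kolyvaginClass_order_eq` minus the class-order clause, which road K
  discards: `exists_conductor_levelIndex_ge_exactDepth_of_prop52`); `h53` = Jetchev Prop. 5.3 FOR THIS FAMILY
  (shape of `JET.JetchevCoreVertexExistence`); `h63` = [J] Thm. 6.3 (printed Thm. 5.2) for the rows (shape of
  the hypothesis `H63` of `JET.jetchevDivisibilityCarrierMult_of_prop52_of_coreVertexExistence`), `t` a number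
  («`ord_p c_q`»).

CONCLUSION (`pointFamily_divisible_of_prop52_of_prop53_of_thm63`): every `P n d` with `n` square-free on
`IsK`-primes of index `≥ s`, `s ≤ t`, is `p^s`-divisible in `A n`. PROOFS: those of the three road-K theorems
with `KolyvaginHeegnerData Dt β ι c ↦ D c`, `d.derivedPoint ↦ P c d`, `Zhang2014.levelIndex ↦ Midx`; the
abstract §6 (`JET.Section6.tamagawaExponent_le_mInfty_of_coreVertices_min`, `…depth_le_mdiv_of_le_mInfty`)
and the two divisibility lemmas (`JET.exists_pow_smul_eq_of_le`, `JET.exists_pow_smul_eq_of_isOfFinAddOrder`)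
are used BY NAME. Instantiation `D c := KolyvaginHeegnerData Dt β ι c` returns road K; instantiation at the
genus presentation family is the skeleton's §1h (workfile `Lines/genus_turnkey_v18.lean` on item 19715).
[cite: Jetchev2008, Prop. 5.3 (p. 823), Thm. 5.2 (p. 821), Proof of Thm. 1.1 (p. 824); arXiv Prop. 6.4, Thm. 6.3, p0017]
[cite: McCallumLMS1991, §5 Prop. 5.2 (p. 304), definitions of ord_p(P_n), M_r (p. 303)] [cite: GrossLMS1991, §4, Lemma 4.3]
presearch: «Kolyvagin system abstract divisibility core vertex bookkeeping» → [corpus: Jetchev2008 §6; McCallumLMS1991 §5;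
MazurRubin2004 §4] frame-bound statements only; `lean search 'of_prop52_of_section6_min'` → road K (frame `KolyvaginHeegnerData`) only.
-/

set_option autoImplicit false

noncomputable section

open scoped Classical

set_option linter.dupNamespace false

namespace Summit.BirchSwinnertonDyer.BirchSwinnertonDyer.Theorems.GenusKolyvagin.FrameFree

open Summit.BirchSwinnertonDyer.Rank1Residual WeierstrassCurve Literature.NumberTheory.EllipticCurves
  Literature.NumberTheory.EllipticCurves.ModularForms

/-- **[J] Prop. 6.4 for an abstract family, from the family's Prop. 5.3** (frame-free re-run of
`JET.exists_coreVertex_of_coreVertexExistence`). With the depth bookkeeping `(mdiv, m)` of the bridge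
(`mdiv` characterised by divisibility of the points `P c d`, `m c = mdiv c` if `mdiv c < Midx c` else `⊤`),
for every level `k ≥ 1` and conductor `c` with `m(c) = m_∞` and `m_∞ + k ≤ M(c)`: a conductor `c'` which is
a core vertex for `k` with `k + m_∞ ≤ M(c')` and `m(c') ≤ m_∞`. From `h53` applied to a datum of exact depth
`m_∞` (non-torsion because `A c` has no `p`-torsion, `hA`, and a torsion point of order prime to `p` is
`p^u`-divisible for every `u`). [cite: Jetchev2008, Prop. 5.3 (p. 823)] [cite: GrossLMS1991, §4, Lemma 4.3] -/
theorem exists_coreVertex_of_prop53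
    {p : ℕ} (hp : p.Prime) (IsK : ℕ → Prop) (idx : ℕ → ℕ) (Midx : ℕ → ℕ∞)
    (hMidx : ∀ (c s : ℕ), (s : ℕ∞) ≤ Midx c ↔ ∀ ℓ ∈ c.primeFactors, s ≤ idx ℓ)
    {D : ℕ → Type*} {A : ℕ → Type*} [∀ c, AddCommGroup (A c)] (P : ∀ c, D c → A c)
    (hA : ∀ c : ℕ, Squarefree c → (∀ ℓ ∈ c.primeFactors, IsK ℓ) → ∀ R : A c, (p : ℤ) • R = 0 → R = 0)
    (Core : ℕ → ℕ → Prop)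
    (h53 : ∀ k : ℕ, 1 ≤ k → ∀ (c : ℕ) (d : D c), Squarefree c → (∀ ℓ ∈ c.primeFactors, IsK ℓ) →
      ∀ s : ℕ, ¬ IsOfFinAddOrder (P c d) → (∃ Q : A c, ((p ^ s : ℕ) : ℤ) • Q = P c d) →
      (¬ ∃ Q : A c, ((p ^ (s + 1) : ℕ) : ℤ) • Q = P c d) → ((s + k : ℕ) : ℕ∞) ≤ Midx c →
      ∃ (c' : ℕ) (d' : D c'), Squarefree c' ∧ (∀ ℓ ∈ c'.primeFactors, IsK ℓ ∧ k + s ≤ idx ℓ) ∧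
        Core k c' ∧ ¬ IsOfFinAddOrder (P c' d') ∧
        ¬ ∃ Q : A c', ((p ^ (s + 1) : ℕ) : ℤ) • Q = P c' d')
    (mdiv m : {c : ℕ // Squarefree c ∧ ∀ ℓ ∈ c.primeFactors, IsK ℓ} → ℕ∞)
    (hchar : ∀ c (u : ℕ), (u : ℕ∞) ≤ mdiv c ↔ ∀ d : D c.1, ∃ Q : A c.1, ((p ^ u : ℕ) : ℤ) • Q = P c.1 d)
    (hmdef : ∀ c, m c = if mdiv c < Midx c.1 then mdiv c else ⊤)
    (mInf k : ℕ) (c : {c : ℕ // Squarefree c ∧ ∀ ℓ ∈ c.primeFactors, IsK ℓ})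
    (hk : 1 ≤ k) (hmc : m c = mInf) (hMc : (mInf : ℕ∞) + k ≤ Midx c.1) :
    ∃ c' : {c : ℕ // Squarefree c ∧ ∀ ℓ ∈ c.primeFactors, IsK ℓ},
      Core k c'.1 ∧ (k : ℕ∞) + mInf ≤ Midx c'.1 ∧ m c' ≤ mInf := by
  -- `mdiv c = mInf < M(c)`
  have hlt : mdiv c < Midx c.1 := by
    by_contra h
    rw [hmdef, if_neg h] at hmc
    exact ENat.top_ne_coe mInf hmc
  have hmdiv : mdiv c = mInf := by rw [hmdef, if_pos hlt] at hmc; exact hmc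
  -- a datum of exact depth `mInf`
  have hDv : ∀ d : D c.1, ∃ Q : A c.1, ((p ^ mInf : ℕ) : ℤ) • Q = P c.1 d :=
    (hchar c mInf).mp hmdiv.symm.le
  have hnotDv : ¬ ∀ d : D c.1, ∃ Q : A c.1, ((p ^ (mInf + 1) : ℕ) : ℤ) • Q = P c.1 d := by
    intro h
    have := (hchar c (mInf + 1)).mpr h
    rw [hmdiv, ENat.coe_le_coe] at this
    omega
  obtain ⟨d', hnd'⟩ := not_forall.mp hnotDv
  have hdiv' := hDv d'
  -- the point of `d'` is not torsion: `A c` has no `p`-torsion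
  have hnt : ¬ IsOfFinAddOrder (P c.1 d') :=
    fun hfin ↦ hnd' (JET.exists_pow_smul_eq_of_isOfFinAddOrder hp (hA c.1 c.2.1 c.2.2) hfin (mInf + 1))
  -- `c ∈ Λ_{mInf + k}`
  have hsM : ((mInf + k : ℕ) : ℕ∞) ≤ Midx c.1 := by push_cast; exact hMc
  -- Prop. 5.3 for the family
  obtain ⟨c', d'', hsq', hℓ', hcore, -, hnd''⟩ :=
    h53 k hk c.1 d' c.2.1 c.2.2 mInf hnt hdiv' hnd' hsM
  let cc : {c : ℕ // Squarefree c ∧ ∀ ℓ ∈ c.primeFactors, IsK ℓ} := ⟨c', hsq', fun ℓ h ↦ (hℓ' ℓ h).1⟩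
  have hM' : (k : ℕ∞) + mInf ≤ Midx c' := by
    have := (hMidx c' (k + mInf)).mpr fun ℓ h ↦ (hℓ' ℓ h).2
    push_cast at this
    exact this
  refine ⟨cc, hcore, hM', ?_⟩
  -- `m(c') ≤ mInf`: the datum `d''` is not divisible to depth `mInf + 1`
  have hle : mdiv cc ≤ mInf := by
    have h1 : ¬ ((mInf + 1 : ℕ) : ℕ∞) ≤ mdiv cc := fun h ↦ hnd'' ((hchar cc (mInf + 1)).mp h d'')
    rw [not_le] at h1
    have h2 : mdiv cc < (mInf : ℕ∞) + 1 := by exact_mod_cast h1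
    exact (ENat.lt_add_one_iff (ENat.coe_ne_top mInf)).mp h2
  have hlt' : mdiv cc < Midx cc.1 := by
    refine lt_of_le_of_lt hle (lt_of_lt_of_le ?_ hM')
    have h1 : (mInf : ℕ∞) < (mInf : ℕ∞) + 1 :=
      (ENat.lt_add_one_iff (ENat.coe_ne_top mInf)).mpr le_rfl
    calc (mInf : ℕ∞) < (mInf : ℕ∞) + 1 := h1
      _ ≤ (k : ℕ∞) + mInf := by
        rw [add_comm]
        exact add_le_add_left (by exact_mod_cast hk) _
  rw [hmdef, if_pos hlt']
  exact hle

/-- **The road-K bridge for an abstract family** (frame-free re-run of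
`JET.derivedPoint_divisible_of_prop52_of_section6_min` composed with `exists_coreVertex_of_prop53`): from
McCallum Prop. 5.2 (`C = {0}`) for the family (`h52`), Jetchev Prop. 5.3 for the family (`h53`), no
`p`-torsion (`hA`) and [J] Thm. 6.3 for the rows (`h63`, over every depth bookkeeping `(mdiv, m, m_∞)` with
Kolyvagin's redefinition — the latter two PROVED here from `h52`), every point `P n d` whose square-free
conductor `n` has all `IsK`-prime factors of index `≥ s`, `s ≤ t`, is `p^s`-divisible. PROOF (road K's): if
`s ≤ m'(n)` done; else McCallum's candidate set `⋃_r {u | some c ∈ Λ^r carries a datum of exact depth u,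
u + 1 ≤ M(ℓ) ∀ ℓ ∣ c}` is non-empty; `m_∞ :=` its minimum; `m_∞ ≤ m(c)` by minimality; `m_∞` is attained at
conductors of arbitrarily large `M(c)` by `c = 1` (`r = 0`) or `h52` (`r ≥ 1`, at `M := max m' (m_∞ + 1)`);
Prop. 6.4 from `h53` (`exists_coreVertex_of_prop53`); then the abstract §6
(`JET.Section6.tamagawaExponent_le_mInfty_of_coreVertices_min`, `JET.Section6.depth_le_mdiv_of_le_mInfty`).
[cite: Jetchev2008, Proof of Thm. 1.1 (p. 824), Prop. 5.3, Thm. 5.2] [cite: McCallumLMS1991, §5 Prop. 5.2 (p. 304)] -/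
theorem pointFamily_divisible_of_prop52_of_prop53_of_thm63
    {p : ℕ} (hp : p.Prime) (IsK : ℕ → Prop) (idx : ℕ → ℕ) (Midx : ℕ → ℕ∞)
    (hMidx : ∀ (c s : ℕ), (s : ℕ∞) ≤ Midx c ↔ ∀ ℓ ∈ c.primeFactors, s ≤ idx ℓ)
    {D : ℕ → Type*} {A : ℕ → Type*} [∀ c, AddCommGroup (A c)] (P : ∀ c, D c → A c)
    (hA : ∀ c : ℕ, Squarefree c → (∀ ℓ ∈ c.primeFactors, IsK ℓ) → ∀ R : A c, (p : ℤ) • R = 0 → R = 0)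
    (Core : ℕ → ℕ → Prop) (t : ℕ)
    (h52 : ∀ r : ℕ, 0 < r → ∀ Mr : ℕ,
      IsLeast {u : ℕ | ∃ (n : ℕ) (d : D n), Squarefree n ∧ n.primeFactors.card = r ∧
          (∀ ℓ ∈ n.primeFactors, IsK ℓ ∧ u + 1 ≤ idx ℓ) ∧
          (∃ Q : A n, ((p ^ u : ℕ) : ℤ) • Q = P n d) ∧
          ¬ ∃ Q : A n, ((p ^ (u + 1) : ℕ) : ℤ) • Q = P n d} Mr →
      ∀ M : ℕ, Mr < M →
        ∃ (n : ℕ) (d : D n), Squarefree n ∧ n.primeFactors.card = r ∧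
          (∀ ℓ ∈ n.primeFactors, IsK ℓ ∧ M ≤ idx ℓ) ∧
          (∃ Q : A n, ((p ^ Mr : ℕ) : ℤ) • Q = P n d) ∧
          ¬ ∃ Q : A n, ((p ^ (Mr + 1) : ℕ) : ℤ) • Q = P n d)
    (h53 : ∀ k : ℕ, 1 ≤ k → ∀ (c : ℕ) (d : D c), Squarefree c → (∀ ℓ ∈ c.primeFactors, IsK ℓ) →
      ∀ s : ℕ, ¬ IsOfFinAddOrder (P c d) → (∃ Q : A c, ((p ^ s : ℕ) : ℤ) • Q = P c d) →
      (¬ ∃ Q : A c, ((p ^ (s + 1) : ℕ) : ℤ) • Q = P c d) → ((s + k : ℕ) : ℕ∞) ≤ Midx c →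
      ∃ (c' : ℕ) (d' : D c'), Squarefree c' ∧ (∀ ℓ ∈ c'.primeFactors, IsK ℓ ∧ k + s ≤ idx ℓ) ∧
        Core k c' ∧ ¬ IsOfFinAddOrder (P c' d') ∧
        ¬ ∃ Q : A c', ((p ^ (s + 1) : ℕ) : ℤ) • Q = P c' d')
    (h63 : ∀ (mdiv m : {c : ℕ // Squarefree c ∧ ∀ ℓ ∈ c.primeFactors, IsK ℓ} → ℕ∞),
      (∀ c (u : ℕ), (u : ℕ∞) ≤ mdiv c ↔ ∀ d : D c.1, ∃ Q : A c.1, ((p ^ u : ℕ) : ℤ) • Q = P c.1 d) →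
      (∀ c, m c = if mdiv c < Midx c.1 then mdiv c else ⊤) →
      ∀ mInf : ℕ, (∀ c, (mInf : ℕ∞) ≤ m c) →
        (∀ m' : ℕ, ∃ c, (m' : ℕ∞) ≤ Midx c.1 ∧ m c = mInf) →
      ∀ (k : ℕ) c, 1 ≤ k → Core k c.1 → m c = mInf → (k : ℕ∞) + mInf ≤ Midx c.1 →
        t < k → mInf < k → t ≤ mInf)
    (s : ℕ) (hs : s ≤ t) (n : ℕ) (d : D n) (hn : Squarefree n)
    (hℓ : ∀ ℓ ∈ n.primeFactors, IsK ℓ ∧ s ≤ idx ℓ) :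
    ∃ Q : A n, ((p ^ s : ℕ) : ℤ) • Q = P n d := by
  -- the conductor type and the divisibility predicate
  set Λ := {c : ℕ // Squarefree c ∧ ∀ ℓ ∈ c.primeFactors, IsK ℓ} with hΛ
  let Dv : ∀ c : ℕ, ℕ → Prop := fun c u ↦ ∀ d : D c, ∃ Q : A c, ((p ^ u : ℕ) : ℤ) • Q = P c d
  have hDv0 : ∀ c, Dv c 0 := fun c d ↦ ⟨P c d, by simp⟩
  have hDvmono : ∀ c {u v : ℕ}, v ≤ u → Dv c u → Dv c v :=
    fun c u v huv h d ↦ JET.exists_pow_smul_eq_of_le p huv (h d)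
  -- the depth function `m'(c)` and its characterisation
  let mdivN : ℕ → ℕ∞ := fun c ↦
    if h : ∃ u, ¬ Dv c u then ((Nat.find h - 1 : ℕ) : ℕ∞) else ⊤
  have hchar : ∀ (c u : ℕ), (u : ℕ∞) ≤ mdivN c ↔ Dv c u := by
    intro c u
    by_cases h : ∃ u, ¬ Dv c u
    · have hfind0 : 0 < Nat.find h := by
        rw [Nat.find_pos]
        exact fun h0 ↦ h0 (hDv0 c)
      simp only [mdivN, dif_pos h, ENat.coe_le_coe]
      constructor
      · intro hu
        have hlt : u < Nat.find h := by omega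
        have := (Nat.lt_find_iff h u).mp hlt u le_rfl
        simpa using this
      · intro hu
        have hlt : u < Nat.find h := by
          rw [Nat.lt_find_iff]
          intro v hv hnv
          exact hnv (hDvmono c hv hu)
        omega
    · simp only [mdivN, dif_neg h, le_top, true_iff]
      exact not_not.mp (not_exists.mp h u)
  -- exact-depth witnesses at a finite depth
  have hexact : ∀ (c u : ℕ), mdivN c = u →
      Dv c u ∧ ∃ d : D c, (∃ Q : A c, ((p ^ u : ℕ) : ℤ) • Q = P c d) ∧
        ¬ ∃ Q : A c, ((p ^ (u + 1) : ℕ) : ℤ) • Q = P c d := by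
    intro c u hcu
    have hu : Dv c u := (hchar c u).mp (by rw [hcu])
    have hu1 : ¬ Dv c (u + 1) := by
      rw [← hchar c (u + 1), hcu, ENat.coe_le_coe]
      omega
    obtain ⟨d, hd⟩ := not_forall.mp hu1
    exact ⟨hu, d, hu d, hd⟩
  -- the functions on `Λ`
  let M : Λ → ℕ∞ := fun c ↦ Midx c.1
  let mdiv : Λ → ℕ∞ := fun c ↦ mdivN c.1
  let m : Λ → ℕ∞ := fun c ↦ if mdiv c < M c then mdiv c else ⊤
  have hm : ∀ c, mdiv c < M c → m c ≤ mdiv c := fun c h ↦ by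
    simp only [m, if_pos h]
    exact le_rfl
  -- the target conductor as an element of `Λ`, and `s ≤ M(n)`
  let cn : Λ := ⟨n, hn, fun ℓ h ↦ (hℓ ℓ h).1⟩
  have hsM : (s : ℕ∞) ≤ M cn := (hMidx n s).mpr fun ℓ h ↦ (hℓ ℓ h).2
  -- it suffices to bound the depth of conductor `n`
  suffices hgoal : (s : ℕ∞) ≤ mdiv cn from ((hchar n s).mp hgoal) d
  by_contra hlt
  rw [not_le] at hlt
  -- `m'(n)` is finite, `= u₀ < s ≤ M(n)`: McCallum's candidate set is non-empty
  obtain ⟨u₀, hu₀⟩ := ENat.ne_top_iff_exists.mp (ne_top_of_lt hlt)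
  let T : ℕ → Prop := fun u ↦ ∃ (c : ℕ) (d : D c), Squarefree c ∧
      (∀ ℓ ∈ c.primeFactors, IsK ℓ ∧ u + 1 ≤ idx ℓ) ∧
      (∃ Q : A c, ((p ^ u : ℕ) : ℤ) • Q = P c d) ∧
      ¬ ∃ Q : A c, ((p ^ (u + 1) : ℕ) : ℤ) • Q = P c d
  -- membership of every `c ∈ Λ` with `m'(c) < M(c)`
  have hTmem : ∀ (c : Λ) (u : ℕ), mdiv c = u → mdiv c < M c → T u := by
    intro c u hcu hcM
    obtain ⟨-, d', hd', hnd'⟩ := hexact c.1 u hcu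
    have hu1 : ((u + 1 : ℕ) : ℕ∞) ≤ M c := by
      rw [hcu] at hcM
      have : (u : ℕ∞) + 1 ≤ M c := (ENat.add_one_le_iff (ENat.coe_ne_top u)).mpr hcM
      exact_mod_cast this
    exact ⟨c.1, d', c.2.1, fun ℓ h ↦ ⟨c.2.2 ℓ h, ((hMidx c.1 (u + 1)).mp hu1) ℓ h⟩, hd', hnd'⟩
  have hT : ∃ u, T u := ⟨u₀, hTmem cn u₀ hu₀.symm (hlt.trans_le hsM)⟩
  -- `m_∞ := min T`
  set mInf : ℕ := Nat.find hT with hmInfdef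
  have hmInfT : T mInf := Nat.find_spec hT
  have hmInfmin : ∀ u, T u → mInf ≤ u := fun u hu ↦ Nat.find_min' hT hu
  -- `hmInf : m_∞ ≤ m(c)`
  have hmInf : ∀ c, (mInf : ℕ∞) ≤ m c := by
    intro c
    by_cases hcM : mdiv c < M c
    · obtain ⟨u, hu⟩ := ENat.ne_top_iff_exists.mp (ne_top_of_lt hcM)
      have : (mInf : ℕ∞) ≤ mdiv c := by
        rw [← hu, ENat.coe_le_coe]
        exact hmInfmin u (hTmem c u hu.symm hcM)
      simp only [m, if_pos hcM]
      exact this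
    · simp only [m, if_neg hcM]
      exact le_top
  -- from an exact-depth-`mInf` datum with `mInf + 1 ≤ M(c)`: `m(c) = m_∞`
  have hmeq : ∀ (c : Λ) (d' : D c.1), ((mInf + 1 : ℕ) : ℕ∞) ≤ M c →
      (¬ ∃ Q : A c.1, ((p ^ (mInf + 1) : ℕ) : ℤ) • Q = P c.1 d') → m c = mInf := by
    intro c d' hMc hnd'
    have hle : mdiv c ≤ mInf := by
      have h1 : ¬ ((mInf + 1 : ℕ) : ℕ∞) ≤ mdiv c := by
        rw [hchar c.1 (mInf + 1)]
        exact fun h ↦ hnd' (h d')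
      rw [not_le] at h1
      have h2 : mdiv c < (mInf : ℕ∞) + 1 := by exact_mod_cast h1
      exact (ENat.lt_add_one_iff (ENat.coe_ne_top mInf)).mp h2
    have hcM : mdiv c < M c := by
      refine lt_of_le_of_lt hle ?_
      have : (mInf : ℕ∞) < (mInf : ℕ∞) + 1 :=
        ENat.lt_add_one_iff (ENat.coe_ne_top mInf) |>.mpr le_rfl
      exact this.trans_le (by exact_mod_cast hMc)
    have hge : (mInf : ℕ∞) ≤ mdiv c := by
      have := hmInf c
      simp only [m, if_pos hcM] at this
      exact this
    simp only [m, if_pos hcM]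
    exact le_antisymm hle hge
  -- `hK : ∀ m', ∃ c, m' ≤ M(c) ∧ m(c) = m_∞` — by `c = 1` (`r = 0`) or McCallum Prop. 5.2 (`r ≥ 1`)
  have hKoly : ∀ m' : ℕ, ∃ c, (m' : ℕ∞) ≤ M c ∧ m c = mInf := by
    intro m'
    obtain ⟨c₀, d₀, hsq₀, hℓ₀, hd₀, hnd₀⟩ := hmInfT
    by_cases hr : c₀.primeFactors.card = 0
    · -- `r = 0`: `c₀ = 1`, `M(1) = ⊤`
      have hc₀ : c₀ = 1 := by
        rcases Nat.primeFactors_eq_empty.mp (Finset.card_eq_zero.mp hr) with h | h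
        · exact absurd h hsq₀.ne_zero
        · exact h
      subst hc₀
      let c1 : Λ := ⟨1, squarefree_one, by simp⟩
      have hM1 : ∀ v : ℕ, (v : ℕ∞) ≤ M c1 := fun v ↦ (hMidx 1 v).mpr (by simp)
      exact ⟨c1, hM1 m', hmeq c1 d₀ (hM1 (mInf + 1)) hnd₀⟩
    · -- `r ≥ 1`: McCallum Prop. 5.2 at `M := max m' (m_∞ + 1)`
      have hr0 : 0 < c₀.primeFactors.card := Nat.pos_of_ne_zero hr
      have hleast : IsLeast {u : ℕ | ∃ (c : ℕ) (d : D c), Squarefree c ∧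
          c.primeFactors.card = c₀.primeFactors.card ∧
          (∀ ℓ ∈ c.primeFactors, IsK ℓ ∧ u + 1 ≤ idx ℓ) ∧
          (∃ Q : A c, ((p ^ u : ℕ) : ℤ) • Q = P c d) ∧
          ¬ ∃ Q : A c, ((p ^ (u + 1) : ℕ) : ℤ) • Q = P c d} mInf :=
        ⟨⟨c₀, d₀, hsq₀, rfl, hℓ₀, hd₀, hnd₀⟩,
          fun u ⟨c, d', hsq, _, hℓ', hd', hnd'⟩ ↦ hmInfmin u ⟨c, d', hsq, hℓ', hd', hnd'⟩⟩
      obtain ⟨c, d', hsq, -, hℓ', hd', hnd'⟩ :=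
        h52 _ hr0 mInf hleast (max m' (mInf + 1))
          (lt_of_lt_of_le (Nat.lt_succ_self mInf) (le_max_right _ _))
      let cc : Λ := ⟨c, hsq, fun ℓ h ↦ (hℓ' ℓ h).1⟩
      have hMc' : ((max m' (mInf + 1) : ℕ) : ℕ∞) ≤ M cc :=
        (hMidx c _).mpr fun ℓ h ↦ (hℓ' ℓ h).2
      refine ⟨cc, le_trans (by exact_mod_cast le_max_left m' (mInf + 1)) hMc',
        hmeq cc d' (le_trans (by exact_mod_cast le_max_right m' (mInf + 1)) hMc') hnd'⟩
  -- Prop. 6.4 (from `h53`) and Thm. 6.3 (`h63`) for these data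
  have h64 : ∀ (k : ℕ) (c : Λ), 1 ≤ k → m c = mInf → (mInf : ℕ∞) + k ≤ M c →
      ∃ c' : Λ, Core k c'.1 ∧ (k : ℕ∞) + mInf ≤ M c' ∧ m c' ≤ mInf :=
    fun k c hk hmc hMc ↦ exists_coreVertex_of_prop53 hp IsK idx Midx hMidx P hA Core h53 mdiv m
      (fun c u ↦ hchar c.1 u) (fun c ↦ rfl) mInf k c hk hmc hMc
  have h63' : ∀ (k : ℕ) (c : Λ), 1 ≤ k → Core k c.1 → m c = mInf → (k : ℕ∞) + mInf ≤ M c →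
      t < k → mInf < k → t ≤ mInf :=
    h63 mdiv m (fun c u ↦ hchar c.1 u) (fun c ↦ rfl) mInf hmInf hKoly
  -- §6 abstract end form (minimal-core-vertex variant)
  have := JET.Section6.depth_le_mdiv_of_le_mInfty M mdiv m hm mInf hmInf
    (JET.Section6.tamagawaExponent_le_mInfty_of_coreVertices_min M m (fun k c ↦ Core k c.1) t mInf
      hmInf hKoly h64 h63')
    s hs cn hsM
  exact absurd this (not_le.mpr hlt)

/-- **Sanity instance: road K is the frame instantiation.** With `D c := KolyvaginHeegnerData Dt β ι c`,
`P c d := d.derivedPoint`, Zhang's `IsKolyvaginPrime ∕ kolyvaginIndex ∕ levelIndex`, `Core k c :=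
Jetchev2008.IsGlobalCoreVertex W K ι τ p k c`, the abstract bridge gives back the conclusion of road K's
`JET.jetchevDivisibilityCarrierMult_of_prop52_of_coreVertexExistence` from the SAME three inputs read for the
frame family (McCallum Prop. 5.2 typed fact, K5, `H63`) — recorded to certify that the abstraction is the
road-K deduction and nothing else. No `p`-torsion from x11b3
(`X11b.RingClassNoTorsion.eq_zero_of_zsmul_pow_eq_zero_ringClassField`, tower at `n = 1`).
[cite: Jetchev2008, Proof of Thm. 1.1 (p. 824)] [cite: McCallumLMS1991, §5 Prop. 5.2 (p. 304)] -/
theorem derivedPoint_divisible_of_prop52_of_coreVertexExistence_of_thm63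
    (h52 : McCallum1991.prop52_exists_conductor_kolyvaginClass_order_eq) (hCV : JET.JetchevCoreVertexExistence)
    (W : WeierstrassCurve ℚ) [W.IsElliptic] [W.IsGloballyMinimal] [NeZero (W.conductorNorm ℤ)]
    (hcm : ¬ W.HasCM) (K : Type) [Field K] [NumberField K] (hK : IsImaginaryQuadratic K)
    (hD3 : NumberField.discr K ≠ -3) (hD4 : NumberField.discr K ≠ -4)
    (hH : SatisfiesHeegnerHypothesis (W.conductorNorm ℤ) K) (τ : K ≃ₐ[ℚ] K) (hτ : τ ≠ 1)
    (p : ℕ) [Fact p.Prime] (hp2 : p ≠ 2) (htower : ∀ n : ℕ, W.HasSurjectiveModNGaloisRep (p ^ n : ℕ))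
    (Dt : ModularParametrizationData W (W.conductorNorm ℤ)) (β : ℤ) (ι : K →+* ℂ)
    [∀ k : ℕ, NumberField (ringClassField K ι k)]
    (d₁ : KolyvaginHeegnerData Dt β ι 1) (hy : ¬ IsOfFinAddOrder d₁.derivedPoint) (t : ℕ)
    (H63 : ∀ (mdiv m : {c : ℕ // Squarefree c ∧ ∀ ℓ ∈ c.primeFactors,
          Zhang2014.IsKolyvaginPrime (W.conductorNorm ℤ) W K p ℓ} → ℕ∞),
      (∀ c (u : ℕ), (u : ℕ∞) ≤ mdiv c ↔ ∀ d : KolyvaginHeegnerData Dt β ι c.1,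
        ∃ Q : (W.baseChange (ringClassField K ι c.1)).toAffine.Point, ((p ^ u : ℕ) : ℤ) • Q = d.derivedPoint) →
      (∀ c, m c = if mdiv c < Zhang2014.levelIndex W p c.1 then mdiv c else ⊤) →
      ∀ mInf : ℕ, (∀ c, (mInf : ℕ∞) ≤ m c) →
        (∀ m' : ℕ, ∃ c, (m' : ℕ∞) ≤ Zhang2014.levelIndex W p c.1 ∧ m c = mInf) →
      ∀ (k : ℕ) c, 1 ≤ k → Jetchev2008.IsGlobalCoreVertex W K ι τ p k c.1 → m c = mInf →
        (k : ℕ∞) + mInf ≤ Zhang2014.levelIndex W p c.1 → t < k → mInf < k → t ≤ mInf)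
    (s : ℕ) (hs : s ≤ t) (n : ℕ) (d : KolyvaginHeegnerData Dt β ι n) (hn : Squarefree n)
    (hℓ : ∀ ℓ ∈ n.primeFactors, Zhang2014.IsKolyvaginPrime (W.conductorNorm ℤ) W K p ℓ ∧
      s ≤ Zhang2014.kolyvaginIndex W p ℓ) :
    ∃ Q : (W.baseChange (ringClassField K ι n)).toAffine.Point, ((p ^ s : ℕ) : ℤ) • Q = d.derivedPoint := by
  have hp : p.Prime := Fact.out
  refine pointFamily_divisible_of_prop52_of_prop53_of_thm63 hp
    (Zhang2014.IsKolyvaginPrime (W.conductorNorm ℤ) W K p) (Zhang2014.kolyvaginIndex W p)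
    (Zhang2014.levelIndex W p) (fun c s ↦ Zhang2014.natCast_le_levelIndex_iff)
    (D := fun c ↦ KolyvaginHeegnerData Dt β ι c) (fun c d ↦ d.derivedPoint)
    (fun c hc _ R hR ↦ X11b.RingClassNoTorsion.eq_zero_of_zsmul_pow_eq_zero_ringClassField W hK ι
      hc.ne_zero hp hp2 (by simpa using htower 1) 1 R (by simpa using hR))
    (fun k c ↦ Jetchev2008.IsGlobalCoreVertex W K ι τ p k c) t (fun r hr Mr hMr M hM ↦ ?_)
    (fun k hk c d hc hcK s hnt hdiv hndiv hsM ↦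
      hCV W hcm K hK hD3 hD4 hH τ hτ p hp2 htower Dt β ι d₁ hy k hk c d hc hcK s hnt hdiv hndiv hsM)
    H63 s hs n d hn hℓ
  obtain ⟨n', d', hsq, hcard, hℓ', -, hdiv, hndiv⟩ :=
    h52 W hcm K hK hD3 hD4 hH p hp2 htower Dt β ι d₁ hy r hr Mr hMr M hM
  exact ⟨n', d', hsq, hcard, hℓ', hdiv, hndiv⟩

end Summit.BirchSwinnertonDyer.BirchSwinnertonDyer.Theorems.GenusKolyvagin.FrameFree

end
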